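import Literature.NumberTheory.Automorphic.Liu2021.RemD5CompanionAdmissibility
import Literature.NumberTheory.Automorphic.Liu2021.RemD5CompanionParity
import HarnessLib

/-!
# [Liu2021, Rem. D.5] — the SIGN SELECTORS of the two branches, in the tree's pinned currency
# (`∃ e, IsAdmissibleElement Φ e ∧ epsOf δ (−e) = ε`): which of the two Rem.-D.5 sign patterns the collection realises

Topic `NumberTheory/Automorphic/Liu2021`; namespace `Literature.NumberTheory.Automorphic.Liu2021.RemD5`.  KERNEL ONLY:
theorems, no definition, no named fact, no `sorry`; continuation of ★ `RemD5CompanionAdmissibility` (p754629) and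
★ `RemD5CompanionParity` (p751708).  **No text of [Liu2021, Rem. D.5] is asserted**: the file computes, for a CM type `Φ`
(at the pin: `Φ_μ = hμ.cmType`), a normaliser `δ` (at the pin: `δ′ = (2δ_F)⁻¹`, the EXACT ε-dictionary of the dual-pair lane,
`CorCM/D2Bridge/OmegaAtDeltaPrime` audit) and a collection `ε` given in the REGISTERED shape
`hadm : ∃ e, IsAdmissibleElement K Φ e ∧ epsOf F⁺ d K δ (−e) = ε` (the `_hadm` binder of the cell's `S1bShape` ∕ `S1bHodgeShape`),
WHICH of the two sign patterns of [Liu2021, Rem. D.5] — «`e′` negative on all of `Ψ`» (the `(1,0)` pattern for a label of CM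
type `Ψ` in normal form `ι₁ ∈ Ψ`) versus «`e′` negative on `Ψ ∖ {ι₁}`, positive at `ι₁`» (the `(0,1)` pattern; = admissibility
for the place-flipped type `CMTypeOps.flip ι₁ Ψ`) — is realised by a generator `e′` of the relevant collection (`epsOf δ e′ = ·`,
Liu's «`ε_v = e′ · Nm E_v^×` for every `v`»), and proves that the two patterns EXCLUDE each other.

* §1 `im_neg_iff_mem_of_isAdmissibleElement`, `im_pos_iff_not_mem_of_isAdmissibleElement` — for `e` admissible for a CM
  TYPE `Φ`: `Im ι(e) < 0 ↔ ι ∈ Φ` and `0 < Im ι(e) ↔ ι ∉ Φ` (a CM type contains exactly one of `ι, ῑ`);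
* §2 `exists_generator_of_isAdmissible_neg` — the registered `hadm` read out: a generator `−e` of `ε` that is `Φ̄`-admissible,
  with the sign dichotomy of `Im ι₁(e)` keyed to `ι₁ ∈ Φ`;
* §3 `not_isAdmissible_flip_of_isAdmissible` — EXCLUSION: a collection admissible for `Ψ` is admissible for no place-flip
  `flip p Ψ` (★ `isAdmissible_epsOf_iff_even_card` + ★ `even_card_filter_flip_iff`: the archimedean counts differ by one);
* §4 `normalForm_selectors_of_isAdmissible_neg` — CASE `ι₁ ∈ Φ̄` (label of type `Φ̄` in normal form): `ε` realises the
  `(1,0)` pattern of `Φ̄` (witness `−e`) and NOT the `(0,1)` pattern;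
  `companion_selectors_of_isAdmissible_neg` — CASE `ι₁ ∈ Φ` (normal form reached at the COMPANION label of [Lem. D.1 (4)],
  type `bar (bar Φ) = Φ`, collection `ε′` = `ε` flipped on a finite set `T` with `Even (#T + ([F⁺:ℚ] − 1))`): `ε′` does NOT
  realise the `(1,0)` pattern of `Φ` and DOES realise the `(0,1)` pattern (★ p754629 §5, rewritten in Liu's direct form);
* §5 `companion_selectors_of_signature` — the same with the parity hypothesis DISCHARGED from the cell's registered
  signature clause `_hsig` («(1,1) at `ι₁`, (2,0) elsewhere») for `T :=` the anisotropic finite places of the hermitian plane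
  `diag(dJ)` (★ p751708 `even_ncard_not_isIsotropic_add_finrank_sub_one`, ★ `LemD1OfPlace.finite_setOf_not_isIsotropic`).

Consumer: line `Cruxes/HLiu418/Lines/F0_AlbCm` of cell hodgecm-mathlib, stub `stub_S1b_hodge : S1bHodgeShape` (the 🟧
orientation bit): with the sign table `F0/P5/p04/SIGN-TABLE-RemD5.md` these selectors are the arithmetic half of
«(1,0) at `ι₁` iff `ι₁ ∈ Φ_μ`» for the registered carrier (label `μᶜ`, collection of `−e`).  HC_CM is proved only modulo the
printed citations until rung 0 closes; this file proves no cell binder.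

## References
* [Liu2021] Y. Liu, Camb. J. Math. 9 (2021) = arXiv:2102.11518: Def. 4.12 (l. 2102–2108; p. 47), Rem. 4.4 (p. 42),
  Lem. D.1 (4) (l. 5235; p. 126), Rem. D.5 (l. 5396–5405; p. 131, NOT asserted here), App. D §D.3 (l. 5355; p. 130).
* [Omeara1963] O. T. O'Meara, *Introduction to Quadratic Forms* (1963), §71 Thm. 71:18/71:19 (through ★ `isAdmissible_epsOf_iff_even_card`).
-/

set_option autoImplicit false

noncomputable section

open scoped Matrix MatrixGroups ComplexOrder
open NumberField IsDedekindDomain NumberField.InfinitePlace NumberField.ComplexEmbedding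
open Literature.AlgebraicGeometry.Liu2021 (IsAdmissibleElement isAdmissibleElement_conj_neg_iff)
open Literature.AlgebraicGeometry.Motives (CMType)
open Literature.NumberTheory.ComplexMultiplication (CMTypeOps.bar CMTypeOps.flip CMTypeOps.mem_bar_iff
  CMTypeOps.conjugate_mem_iff_notMem CMTypeOps.mem_iff_conjugate_notMem CMTypeOps.flip_flip CMTypeOps.mem_flip_iff)
open Literature.NumberTheory.Automorphic.UnitaryGroup

namespace Literature.NumberTheory.Automorphic.Liu2021.RemD5

variable {K : Type} [Field K] [NumberField K] [IsCMField K]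

/-! ## §1 The sign of `Im ι(e)` for an admissible `e`, keyed to membership in the CM type -/

/-- **`Im ι(e) < 0 ↔ ι ∈ Φ`** for `e` admissible for the CM TYPE `Φ` ([Liu2021, Def. 4.12]: «`τ′(e)` has negative imaginary part
for every `τ′ ∈ Φ_μ`»; off `Φ` the conjugate embedding lies in `Φ`, and `Im ῑ(e) = −Im ι(e)`). [cite: Liu2021, Def. 4.12 (l. 2102–2108)] -/
theorem im_neg_iff_mem_of_isAdmissibleElement (Φ : CMType K) {e : K} (he : IsAdmissibleElement K Φ.1 e) (ι : K →+* ℂ) :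
    (ι e).im < 0 ↔ ι ∈ Φ.1 := by
  refine ⟨fun h => ?_, fun h => he.2.2 ι h⟩
  by_contra hι
  have hc : conjugate ι ∈ Φ.1 := (CMTypeOps.conjugate_mem_iff_notMem Φ ι).2 hι
  have h' := he.2.2 _ hc
  rw [conjugate_coe_eq, Complex.conj_im] at h'
  linarith

/-- **`0 < Im ι(e) ↔ ι ∉ Φ`** for `e` admissible for the CM type `Φ` (`e ≠ 0` purely imaginary, so `Im ι(e) ≠ 0`).
[cite: Liu2021, Def. 4.12 (l. 2102–2108)] -/
theorem im_pos_iff_not_mem_of_isAdmissibleElement (Φ : CMType K) {e : K} (he : IsAdmissibleElement K Φ.1 e) (ι : K →+* ℂ) :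
    0 < (ι e).im ↔ ι ∉ Φ.1 := by
  refine ⟨fun h hι => ?_, fun hι => ?_⟩
  · have h' := (im_neg_iff_mem_of_isAdmissibleElement Φ he ι).2 hι
    linarith
  · have hc : conjugate ι ∈ Φ.1 := (CMTypeOps.conjugate_mem_iff_notMem Φ ι).2 hι
    have h' := he.2.2 _ hc
    rw [conjugate_coe_eq, Complex.conj_im] at h'
    linarith

/-- … and for the negative `−e` (the generator appearing in the registered `_hadm`): `Im ι(−e) < 0 ↔ ι ∉ Φ`.
[cite: Liu2021, Def. 4.12 (l. 2102–2108); Rem. 4.4] -/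
theorem im_neg_apply_neg_iff_not_mem_of_isAdmissibleElement (Φ : CMType K) {e : K} (he : IsAdmissibleElement K Φ.1 e)
    (ι : K →+* ℂ) : (ι (-e)).im < 0 ↔ ι ∉ Φ.1 := by
  rw [map_neg, Complex.neg_im, neg_lt_zero]
  exact im_pos_iff_not_mem_of_isAdmissibleElement Φ he ι

/-! ## §2 The registered binder `∃ e, IsAdmissibleElement Φ e ∧ epsOf δ (−e) = ε` read out -/

omit [NumberField K] [IsCMField K] in
/-- `Φ̄̄ = Φ` (conjugating a CM type twice gives it back; [Liu2021, Rem. 4.4] «`Ψ_{μᶜ}` is the opposite CM type of `Ψ_μ`»,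
`(μᶜ)ᶜ = μ`). [cite: Liu2021, Rem. 4.4] -/
theorem bar_bar (Φ : CMType K) : CMTypeOps.bar (CMTypeOps.bar Φ) = Φ :=
  Subtype.ext (compl_compl Φ.1)

/-- **The registered `_hadm` read out.**  From `∃ e, e Φ-admissible ∧ epsOf δ (−e) = ε`: the collection `ε` is generated
(`epsOf δ · = ε`, Liu's «`ε_v = e′ Nm E_v^×` for every `v`») by `e′ := −e`, which is admissible for the CONJUGATE type `Φ̄`
(★ `isAdmissibleElement_conj_neg_iff`), and for every embedding `ι₁`: `Im ι₁(e) < 0 ↔ ι₁ ∈ Φ`, `0 < Im ι₁(e) ↔ ι₁ ∉ Φ`,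
`Im ι₁(e′) < 0 ↔ ι₁ ∈ Φ̄`.  (At the pin `Φ = Φ_μ`, `Φ̄ = Φ_{μᶜ}` by ★ `IsConjugateSymplectic.cmType_galConj`: the registered
collection is `μᶜ`-admissible in the sense of [Liu2021, Def. 4.12].) [cite: Liu2021, Def. 4.12 (l. 2102–2108); Rem. 4.4] -/
theorem exists_generator_of_isAdmissible_neg (Φ : CMType K) (d : maximalRealSubfield K) (δ : K)
    (ε : Def411WeilCarriers.Eps (maximalRealSubfield K) d)
    (hadm : ∃ e : K, IsAdmissibleElement K Φ.1 e ∧ Def411WeilCarriers.epsOf (maximalRealSubfield K) d K δ (-e) = ε)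
    (ι₁ : K →+* ℂ) :
    ∃ e : K, Def411WeilCarriers.epsOf (maximalRealSubfield K) d K δ (-e) = ε ∧ IsAdmissibleElement K Φ.1 e ∧
      IsAdmissibleElement K (CMTypeOps.bar Φ).1 (-e) ∧
      ((ι₁ e).im < 0 ↔ ι₁ ∈ Φ.1) ∧ (0 < (ι₁ e).im ↔ ι₁ ∉ Φ.1) ∧ ((ι₁ (-e)).im < 0 ↔ ι₁ ∈ (CMTypeOps.bar Φ).1) := by
  obtain ⟨e, he, hε⟩ := hadm
  refine ⟨e, hε, he, ?_, im_neg_iff_mem_of_isAdmissibleElement Φ he ι₁,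
    im_pos_iff_not_mem_of_isAdmissibleElement Φ he ι₁, ?_⟩
  · rw [coe_bar_eq_setOf, isAdmissibleElement_conj_neg_iff]
    exact he
  · rw [CMTypeOps.mem_bar_iff]
    exact im_neg_apply_neg_iff_not_mem_of_isAdmissibleElement Φ he ι₁

/-! ## §3 Exclusion: the two Rem.-D.5 sign patterns are never realised by the same collection -/

open scoped Classical in
/-- **A collection admissible for `Ψ` is admissible for no place-flip `Ψ^{(p)}`** (the «all negative on `Ψ`» and
«negative on `Ψ ∖ {p}`, positive at `p`» patterns exclude each other): by ★ `isAdmissible_epsOf_iff_even_card` both would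
force `#{v : ε_v ≠ 1} + #{w : Im ψ_w(δ) > 0}` even for `Ψ` and for `Ψ^{(p)}`, whose archimedean counts differ by exactly one
(★ `even_card_filter_flip_iff`). [cite: Liu2021, Def. 4.12 (l. 2102–2108); Rem. D.5 (l. 5396–5405)] [cite: Omeara1963, §71 Thm. 71:18] -/
theorem not_isAdmissible_flip_of_isAdmissible (Ψ : CMType K) (p : K →+* ℂ) {δ : K} (hδ : IsCMField.complexConj K δ = -δ)
    (hδ0 : δ ≠ 0) (d : maximalRealSubfield K) (hd0 : d ≠ 0)
    (hdneg : ∀ (w : InfinitePlace (maximalRealSubfield K)) (hw : w.IsReal), InfinitePlace.embedding_of_isReal hw d < 0)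
    (ε : Def411WeilCarriers.Eps (maximalRealSubfield K) d)
    (h : ∃ e : K, IsAdmissibleElement K Ψ.1 e ∧ Def411WeilCarriers.epsOf (maximalRealSubfield K) d K δ e = ε) :
    ¬ ∃ e : K, IsAdmissibleElement K (CMTypeOps.flip p Ψ).1 e ∧ Def411WeilCarriers.epsOf (maximalRealSubfield K) d K δ e = ε := by
  rw [isAdmissible_epsOf_iff_even_card K Ψ hδ hδ0 d hd0 hdneg ε] at h
  rw [isAdmissible_epsOf_iff_even_card K (CMTypeOps.flip p Ψ) hδ hδ0 d hd0 hdneg ε]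
  obtain ⟨-, hev⟩ := h
  rintro ⟨-, hev'⟩
  have hF := even_card_filter_flip_iff Ψ p hδ hδ0
  rw [Nat.even_iff] at hev hev'
  rw [Nat.even_iff, Nat.even_iff] at hF
  omega

/-- … the same exclusion with the rôles exchanged: admissible for `Ψ^{(p)}` ⇒ not admissible for `Ψ` (`(Ψ^{(p)})^{(p)} = Ψ`).
[cite: Liu2021, Def. 4.12 (l. 2102–2108); Rem. D.5 (l. 5396–5405)] -/
theorem not_isAdmissible_of_isAdmissible_flip (Ψ : CMType K) (p : K →+* ℂ) {δ : K} (hδ : IsCMField.complexConj K δ = -δ)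
    (hδ0 : δ ≠ 0) (d : maximalRealSubfield K) (hd0 : d ≠ 0)
    (hdneg : ∀ (w : InfinitePlace (maximalRealSubfield K)) (hw : w.IsReal), InfinitePlace.embedding_of_isReal hw d < 0)
    (ε : Def411WeilCarriers.Eps (maximalRealSubfield K) d)
    (h : ∃ e : K, IsAdmissibleElement K (CMTypeOps.flip p Ψ).1 e ∧ Def411WeilCarriers.epsOf (maximalRealSubfield K) d K δ e = ε) :
    ¬ ∃ e : K, IsAdmissibleElement K Ψ.1 e ∧ Def411WeilCarriers.epsOf (maximalRealSubfield K) d K δ e = ε := by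
  have h' := not_isAdmissible_flip_of_isAdmissible (CMTypeOps.flip p Ψ) p hδ hδ0 d hd0 hdneg ε h
  rwa [CMTypeOps.flip_flip] at h'

/-! ## §4 The two cases of the normal form `ι₁ ∈ (type of the label)` -/

/-- **CASE `ι₁ ∈ Φ̄` (the registered label, of CM type `Φ̄`, is in [Liu2021, Prop. D.4 (1)]'s normal form).**  From the
registered `hadm`: the collection `ε` realises the «negative on all of `Φ̄`» pattern (witness `−e`; = [Liu2021, Def. 4.12]
admissibility for `Φ̄`, Rem. D.5's `(1,0)` criterion for a label of type `Φ̄`) and does NOT realise the «negative on `Φ̄ ∖ {ι₁}`,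
positive at `ι₁`» pattern (`flip ι₁ Φ̄`; Rem. D.5's `(0,1)` criterion) — for every `ι₁`.  (Its READING as Rem. D.5's first branch
needs `ι₁ ∈ Φ̄`; the arithmetic does not.) [cite: Liu2021, Def. 4.12 (l. 2102–2108); Rem. D.5 (l. 5396–5405)] [cite: Omeara1963, §71 Thm. 71:18] -/
theorem normalForm_selectors_of_isAdmissible_neg (Φ : CMType K) (ι₁ : K →+* ℂ) {δ : K} (hδ : IsCMField.complexConj K δ = -δ)
    (hδ0 : δ ≠ 0) (d : maximalRealSubfield K) (hd0 : d ≠ 0)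
    (hdneg : ∀ (w : InfinitePlace (maximalRealSubfield K)) (hw : w.IsReal), InfinitePlace.embedding_of_isReal hw d < 0)
    (ε : Def411WeilCarriers.Eps (maximalRealSubfield K) d)
    (hadm : ∃ e : K, IsAdmissibleElement K Φ.1 e ∧ Def411WeilCarriers.epsOf (maximalRealSubfield K) d K δ (-e) = ε) :
    (∃ e : K, IsAdmissibleElement K (CMTypeOps.bar Φ).1 e ∧ Def411WeilCarriers.epsOf (maximalRealSubfield K) d K δ e = ε) ∧
      ¬ ∃ e : K, IsAdmissibleElement K (CMTypeOps.flip ι₁ (CMTypeOps.bar Φ)).1 e ∧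
        Def411WeilCarriers.epsOf (maximalRealSubfield K) d K δ e = ε := by
  have h1 : ∃ e : K, IsAdmissibleElement K (CMTypeOps.bar Φ).1 e ∧
      Def411WeilCarriers.epsOf (maximalRealSubfield K) d K δ e = ε :=
    (exists_isAdmissibleElement_neg_iff_bar Φ d δ ε).1 hadm
  exact ⟨h1, not_isAdmissible_flip_of_isAdmissible (CMTypeOps.bar Φ) ι₁ hδ hδ0 d hd0 hdneg ε h1⟩

/-- **CASE `ι₁ ∈ Φ` (normal form reached at the COMPANION label of [Liu2021, Lem. D.1 (4)], CM type `Φ̄̄ = Φ`).**  With `ε′` the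
collection `ε` flipped on a finite set `T` of finite places (`ε′ = ε` off `T`, `ε′_v ≠ 1 ↔ ε_v = 1` on `T`) of parity
`Even (#T + ([F⁺:ℚ] − 1))` — at the pin `T` = the anisotropic places of the hermitian plane, ★ p751708 — the companion collection
`ε′` does NOT realise the «negative on all of `Φ`» pattern (Rem. D.5's `(1,0)` criterion for the companion label) and DOES realise
the «negative on `Φ ∖ {ι₁}`, positive at `ι₁`» pattern `flip ι₁ Φ` (the `(0,1)` criterion): ★ p754629
`not_isAdmissible_companion_of_flip` ∕ `isAdmissible_flip_companion_of_flip`, rewritten in Liu's direct form `epsOf δ e′ = ε′`.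
(Reading as Rem. D.5's second branch needs `ι₁ ∈ Φ`; the arithmetic does not.)
[cite: Liu2021, Def. 4.12 (l. 2102–2108); Rem. 4.4; Lem. D.1 (4) (l. 5235); Rem. D.5 (l. 5396–5405)] [cite: Omeara1963, §71 Thm. 71:19] -/
theorem companion_selectors_of_isAdmissible_neg (Φ : CMType K) (ι₁ : K →+* ℂ) {δ : K} (hδ : IsCMField.complexConj K δ = -δ)
    (hδ0 : δ ≠ 0) (d : maximalRealSubfield K) (hd0 : d ≠ 0)
    (hdneg : ∀ (w : InfinitePlace (maximalRealSubfield K)) (hw : w.IsReal), InfinitePlace.embedding_of_isReal hw d < 0)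
    (ε ε' : Def411WeilCarriers.Eps (maximalRealSubfield K) d)
    {T : Set (HeightOneSpectrum (𝓞 (maximalRealSubfield K)))} (hT : T.Finite) (hoff : ∀ v ∉ T, ε' v = ε v)
    (hon : ∀ v ∈ T, ε' v ≠ 1 ↔ ε v = 1) (hpar : Even (T.ncard + (Module.finrank ℚ (maximalRealSubfield K) - 1)))
    (hadm : ∃ e : K, IsAdmissibleElement K Φ.1 e ∧ Def411WeilCarriers.epsOf (maximalRealSubfield K) d K δ (-e) = ε) :
    (¬ ∃ e : K, IsAdmissibleElement K Φ.1 e ∧ Def411WeilCarriers.epsOf (maximalRealSubfield K) d K δ e = ε') ∧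
      ∃ e : K, IsAdmissibleElement K (CMTypeOps.flip ι₁ Φ).1 e ∧ Def411WeilCarriers.epsOf (maximalRealSubfield K) d K δ e = ε' := by
  constructor
  · -- ★ `not_isAdmissible_companion_of_flip`: `¬ ∃ e, e Φ̄-admissible ∧ epsOf δ (−e) = ε′`, i.e. `¬ P(Φ̄̄ = Φ, ε′)`
    have h := not_isAdmissible_companion_of_flip Φ hδ hδ0 d hd0 hdneg ε ε' hT hoff hon hpar hadm
    rw [exists_isAdmissibleElement_neg_iff_bar, bar_bar] at h
    exact h
  · -- ★ `isAdmissible_flip_companion_of_flip`: `∃ e, e (flip ι₁ Φ̄)-admissible ∧ epsOf δ (−e) = ε′`, i.e. `P((flip ι₁ Φ̄)‾ = flip ι₁ Φ, ε′)`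
    have h := isAdmissible_flip_companion_of_flip Φ ι₁ hδ hδ0 d hd0 hdneg ε ε' hT hoff hon hpar hadm
    rw [exists_isAdmissibleElement_neg_iff_bar, bar_flip, bar_bar] at h
    exact h

/-! ## §5 The parity hypothesis discharged from the registered signature clause `_hsig` -/

/-- **CASE `ι₁ ∈ Φ` in the registered binders' currency.**  Under the cell's signature clause `_hsig` (signature `(1,1)` at `ι₁`,
positive definite at the other places) for a real diagonal Gram matrix `diag(dJ)` of the hermitian PLANE, take `T :=` the set of
finite places of `F⁺` at which the plane of the local standing data (any purely imaginary `δ₀ ≠ 0`) is ANISOTROPIC — the set on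
which [Liu2021, Lem. D.1 (4)]'s companion relabel changes the collection; its parity `Even (#T + ([F⁺:ℚ] − 1))` is ★ p751708 and its
finiteness ★ `LemD1OfPlace.finite_setOf_not_isIsotropic`.  Then for every companion collection `ε′` (= `ε` flipped exactly on `T`)
the conclusion of `companion_selectors_of_isAdmissible_neg` holds: NOT the `(1,0)` pattern of `Φ`, YES the `(0,1)` pattern.
[cite: Liu2021, App. D §D.3 (l. 5355); Lem. D.1 (4) (l. 5235); Def. 4.12 (l. 2102–2108); Rem. D.5 (l. 5396–5405)] [cite: Omeara1963, §71 Thm. 71:18] -/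
theorem companion_selectors_of_signature (Φ : CMType K) (ι₁ : K →+* ℂ) {δ : K} (hδ : IsCMField.complexConj K δ = -δ)
    (hδ0 : δ ≠ 0) (d : maximalRealSubfield K) (hd0 : d ≠ 0)
    (hdneg : ∀ (w : InfinitePlace (maximalRealSubfield K)) (hw : w.IsReal), InfinitePlace.embedding_of_isReal hw d < 0)
    (dJ : Fin 2 → K) (hdJ : ∀ i, IsCMField.complexConj K (dJ i) = dJ i) (hdJ0 : ∀ i, dJ i ≠ 0)
    (hsig : (∃ Tstar : GL (Fin 2) ℂ,
        formCongr (starRingEnd ℂ) Tstar ((Matrix.diagonal dJ).map ι₁) = Matrix.diagonal ![(1 : ℂ), -1]) ∧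
      ∀ τ' : K →+* ℂ, InfinitePlace.mk τ' ≠ InfinitePlace.mk ι₁ → ((Matrix.diagonal dJ).map τ').PosDef)
    {δ₀ : K} (hcδ₀ : IsCMField.complexConj K δ₀ = -δ₀) (hδ₀ : δ₀ ≠ 0)
    (hJh : ((Matrix.diagonal dJ).map (IsCMField.complexConj K))ᵀ = Matrix.diagonal dJ) (hJdet : (Matrix.diagonal dJ).det ≠ 0)
    (ε ε' : Def411WeilCarriers.Eps (maximalRealSubfield K) d)
    (hoff : ∀ v, LemD1.IsIsotropic (LemD1OfPlace.standingData K v (IsCMField.complexConj K) 2 (Matrix.diagonal dJ) hcδ₀ hδ₀ le_rfl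
        hJh hJdet) → ε' v = ε v)
    (hon : ∀ v, ¬ LemD1.IsIsotropic (LemD1OfPlace.standingData K v (IsCMField.complexConj K) 2 (Matrix.diagonal dJ) hcδ₀ hδ₀ le_rfl
        hJh hJdet) → (ε' v ≠ 1 ↔ ε v = 1))
    (hadm : ∃ e : K, IsAdmissibleElement K Φ.1 e ∧ Def411WeilCarriers.epsOf (maximalRealSubfield K) d K δ (-e) = ε) :
    (¬ ∃ e : K, IsAdmissibleElement K Φ.1 e ∧ Def411WeilCarriers.epsOf (maximalRealSubfield K) d K δ e = ε') ∧
      ∃ e : K, IsAdmissibleElement K (CMTypeOps.flip ι₁ Φ).1 e ∧ Def411WeilCarriers.epsOf (maximalRealSubfield K) d K δ e = ε' := by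
  set T : Set (HeightOneSpectrum (𝓞 (maximalRealSubfield K))) := {v |
      ¬ LemD1.IsIsotropic (LemD1OfPlace.standingData K v (IsCMField.complexConj K) 2 (Matrix.diagonal dJ) hcδ₀ hδ₀ le_rfl
        hJh hJdet)} with hT_def
  -- the real diagonal `t` with `diag(dJ) = diag(t) ⊗ 1` and `d₀ := δ₀²`
  let t : Fin 2 → maximalRealSubfield K := fun i => ⟨dJ i, (IsCMField.complexConj_eq_self_iff (K := K) (dJ i)).1 (hdJ i)⟩
  have hJ : Matrix.diagonal dJ = (Matrix.diagonal t).map (algebraMap (maximalRealSubfield K) K) := by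
    rw [Matrix.diagonal_map (map_zero _)]
    rfl
  have ht : ∀ i, t i ≠ 0 := fun i h => hdJ0 i (congrArg Subtype.val h)
  let d₀ : maximalRealSubfield K :=
    ⟨δ₀ * δ₀, (IsCMField.complexConj_eq_self_iff (K := K) (δ₀ * δ₀)).1 (by rw [map_mul, hcδ₀, neg_mul_neg])⟩
  have hd₀ : δ₀ * δ₀ = algebraMap (maximalRealSubfield K) K d₀ := rfl
  have hTfin : T.Finite :=
    LemD1OfPlace.finite_setOf_not_isIsotropic K (IsCMField.complexConj K) hcδ₀ hδ₀ t hJ hJh hJdet hd₀ ht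
  have hpar : Even (T.ncard + (Module.finrank ℚ (maximalRealSubfield K) - 1)) :=
    even_ncard_not_isIsotropic_add_finrank_sub_one K ι₁ dJ hdJ hdJ0 hsig hcδ₀ hδ₀ hJh hJdet
  exact companion_selectors_of_isAdmissible_neg Φ ι₁ hδ hδ0 d hd0 hdneg ε ε' hTfin
    (fun v hv => hoff v (by simpa [hT_def] using hv)) (fun v hv => hon v hv) hpar hadm

end Literature.NumberTheory.Automorphic.Liu2021.RemD5

end
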